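import Summits.CriticalPhenomena.PercolationContinuityZ3.Theorems.PercNearOneGluingNoHeavyLowerTailSahiC4CubeColourCheck

/-!
# Sahi's `C₄` on `{0,1}^5`: the 4-coloured-antichain check `colourCheck4 5 26`, chunk A1 (first point 3, second point 5 opening colour 1)
# — COMPUTATIONAL (`native_decide`)

Support file (cell `prim-sahi`, seat `prim-sahi-typer` gen 28; `--supports stmt-CriticalPhenomena-4575`; COMPUTATIONAL).  One piece of the
evaluation of `colourCheck4 5 26` (…`SahiC4CubeColourCheck`: the four-copy digit test over the quadruples co-generated by the 4-coloured antichains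
of the `5`-cube, colourings up to relabelling, `703 905` digit tests ≈ 20 min of compiled evaluation in all).  The gate's elaboration budget is
600 s, so the search is split along the skip chain of `goC4` by the FIRST chosen point `q'` (`brTop`) and, for the two heavy first points
`q' = 3, 7` (39 % each), by the SECOND chosen point `q''` and its colour (`brSnd`, `sndCol0/1`).  Digit-test shares: A1 = (3; 5, new colour)
22.7 %, A2 = (3; rest) 16.3 %, B1 = (7; 11, new colour) 22.7 %, B2 = (7; rest) 16.3 %, C = first points 5, 11: 16.3 %, D = all other first points
5.7 %.  The pieces are assembled in …`SahiC4CubeFive` (`colourCheck4_of_brTop`, `brTop_of_brSnd`, `brSnd_of_sndCol`).  This chunk: 159 728 digit tests. [this work]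
-/

namespace Summit.CriticalPhenomena.PercolationContinuityZ3.Theorems.SahiC4Cube

/-- Chunk A1 of `colourCheck4 5 26`: first point `3`, second point `5` with the new colour `1` (compiled evaluation). [this work] -/
theorem colour4Chunk_five_a1 : sndCol1 5 26 3 5 = true := by
  native_decide

end Summit.CriticalPhenomena.PercolationContinuityZ3.Theorems.SahiC4Cube
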